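import Mathlib
import Summits.ValiantsHypothesis.ValiantsHypothesis.Theorems.BarrierLeverDefinableEquationsProductDepthWallTwoEngine

/-!
# Route BarrierLever — crux `DefinableEquations` (stmt-8745) / item `SingleSizeEquations`
# (stmt-8749): LST's queue automaton in MERGE ORDER has linearly many transitions, hence
# `L(P_w) ≤ 6 · #variables` for words in merge order (val-np-p5 g15, part 2 of `…ProductDepthWallTwo*`)

The tree's queue automaton for the word polynomial `P_w` (`LSTWord.wordStep`, LST 2025 Lemma 22)
has `2^{|w_{[t]}|}` states at layer `t`.  Call block `t` *in merge position* if it is appended to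
the currently SHORTER-OR-EQUAL stream (`streamLen (pos t) t ≤ streamLen (!pos t) t`).

* §2 In merge position layer `t` has at most `2^{max(|w_{[t]}|, |w_t|)}` transitions
  (`edges_wordStep_le_of_mergeAt`: a push only happens onto an EMPTY overhang; in a compare with
  `|w_t| ≤ |w_{[t]}|` each overhang admits one label, with `|w_t| > |w_{[t]}|` each label is admitted
  by one overhang — a double count), and `|w_{[t+1]}| = ||w_{[t]}| - |w_t||` (`overLen_succ_of_mergeAt`).
* §3 Potential `Φ_t = 2·2^{|w_{[t]}|}`: for letters `≥ 1`, `∑_t 2^{max(|w_{[t]}|,|w_t|)} ≤ 3 ∑_t 2^{|w_t|}`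
  (`sum_pow_max_le`).
* §4 With the sparse-automaton engine (`complexity_acceptedPoly_le`, part 1): a word ENTIRELY in
  merge order with letters `≥ 1` has `L(P_w) ≤ 6 · ∑_t 2^{|w_t|} = 6 · #variables`
  (`complexity_wordPoly_le_of_merge`).  LST's own (index) order is NOT merge order in general
  (pushes onto non-empty overhangs cost up to `n` each); part 3 reorders.

What this is NOT: nothing on the crux (b = 2 OPEN, Chatterjee–Tengse §1.3 dir. 2) or `VP ≠ VNP`;
no definitions, no named facts, standard axioms.
Refs: Limaye–Srinivasan–Tavenas, J. ACM 72 (2025) Art. 26, Lemma 22; Bürgisser 2000, Rem. 2.7.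
-/

-- `Summit.ValiantsHypothesis.ValiantsHypothesis.…` repeats a component (D-0017 layout); mandated.
set_option linter.dupNamespace false

noncomputable section

namespace Summit.ValiantsHypothesis.ValiantsHypothesis.Theorems.BarrierLeverDefinableEquations

open MvPolynomial
open Literature.Computability.AlgebraicComplexity
open Literature.Computability.AlgebraicComplexity.LSTWord
open scoped BigOperators

namespace ProductDepthWallTwo

/-! ## §2 LST's queue automaton in MERGE ORDER: few transitions, and the overhang recursion -/

section Queue

variable {D : ℕ} (k : ℕ) (pos : Fin D → Bool)

/-! Block `t` is in *merge position* if it is appended to the currently SHORTER-OR-EQUAL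
stream, `streamLen (pos t) t ≤ streamLen (!pos t) t`.  In LST's index order this may fail (pushes
onto a non-empty overhang of the same side); the sequel reorders the blocks of a word so that
it holds on a prefix and the remaining blocks are free. -/

/-- Definedness of the queue transition: a push (block on the longer-or-equal side) is always
defined, a compare is defined iff the label is compatible with the overhang.
[cite: LimayeSrinivasanTavenas2025, Lemma 22] -/
theorem isSome_wordStep_iff (t : Fin D) (o : List.Vector Bool (overLen k pos t))
    (b : BlockVar k pos t) :
    (wordStep k pos t o b).isSome ↔
      streamLen k pos (!pos t) t ≤ streamLen k pos (pos t) t ∨ Compat (List.ofFn b) o.1 := by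
  unfold wordStep
  split_ifs <;> simp_all

/-- A block has `2^{|w_t|}` labels. [cite: LimayeSrinivasanTavenas2025, §2.2] -/
theorem card_blockVar (t : Fin D) : Fintype.card (BlockVar k pos t) = 2 ^ letterSize k pos t := by
  rw [Fintype.card_fun, Fintype.card_bool, Fintype.card_fin]

/-- Crude count: at most `#states · #labels = 2^{|w_{[t]}|} · 2^{|w_t|}` transitions at layer `t`.
[cite: LimayeSrinivasanTavenas2025, Lemma 22] -/
theorem edges_wordStep_le (t : Fin D) :
    edges (St := fun t => List.Vector Bool (overLen k pos t)) (wordStep k pos) t ≤ 2 ^ overLen k pos t * 2 ^ letterSize k pos t := by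
  classical
  unfold edges outDeg
  calc ∑ o : List.Vector Bool (overLen k pos t),
        (Finset.univ.filter fun b : BlockVar k pos t => (wordStep k pos t o b).isSome).card
      ≤ ∑ _o : List.Vector Bool (overLen k pos t), 2 ^ letterSize k pos t :=
        Finset.sum_le_sum fun o _ => (Finset.card_filter_le _ _).trans
          (by rw [Finset.card_univ, card_blockVar])
    _ = _ := by rw [Finset.sum_const, Finset.card_univ, card_vector, Fintype.card_bool, smul_eq_mul]

/-- Two prefixes of one list having the same length are equal. [folklore] -/
theorem eq_of_prefix_of_prefix {l₁ l₂ l : List Bool} (h₁ : l₁ <+: l) (h₂ : l₂ <+: l)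
    (hl : l₁.length = l₂.length) : l₁ = l₂ := by
  rw [List.prefix_iff_eq_take] at h₁ h₂
  rw [h₁, h₂, hl]

/-- **Compare layers are sparse**: if block `t` lies on the STRICTLY shorter side, layer `t` has
at most `2^{max(|w_{[t]}|, |w_t|)}` transitions — for `|w_t| ≤ |w_{[t]}|` each overhang admits ONE
label (its first `|w_t|` bits), for `|w_t| > |w_{[t]}|` each label is admitted by ONE overhang
(its first `|w_{[t]}|` bits). [cite: LimayeSrinivasanTavenas2025, Lemma 22] -/
theorem edges_wordStep_le_of_lt (t : Fin D)
    (hlt : streamLen k pos (pos t) t < streamLen k pos (!pos t) t) :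
    edges (St := fun t => List.Vector Bool (overLen k pos t)) (wordStep k pos) t ≤ 2 ^ max (overLen k pos t) (letterSize k pos t) := by
  classical
  have hiff : ∀ (o : List.Vector Bool (overLen k pos t)) (b : BlockVar k pos t),
      (wordStep k pos t o b).isSome ↔ Compat (List.ofFn b) o.1 := by
    intro o b
    rw [isSome_wordStep_iff]
    exact ⟨fun h => h.resolve_left (not_le.2 hlt), Or.inr⟩
  unfold edges outDeg
  simp_rw [hiff]
  by_cases hbo : letterSize k pos t ≤ overLen k pos t
  · -- each overhang admits at most one label
    calc ∑ o : List.Vector Bool (overLen k pos t),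
          (Finset.univ.filter fun b : BlockVar k pos t => Compat (List.ofFn b) o.1).card
        ≤ ∑ _o : List.Vector Bool (overLen k pos t), 1 := by
          refine Finset.sum_le_sum fun o _ => Finset.card_le_one.2 fun b hb b' hb' => ?_
          rw [Finset.mem_filter] at hb hb'
          have hlen : (List.ofFn b).length ≤ o.1.length := by
            rw [List.length_ofFn, o.2]; exact hbo
          have hlen' : (List.ofFn b').length ≤ o.1.length := by
            rw [List.length_ofFn, o.2]; exact hbo
          have h1 := (compat_iff_prefix_of_le hlen).1 hb.2.symm
          have h2 := (compat_iff_prefix_of_le hlen').1 hb'.2.symm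
          exact List.ofFn_injective (eq_of_prefix_of_prefix h1 h2 (by simp))
      _ ≤ _ := by
          rw [Finset.sum_const, Finset.card_univ, card_vector, Fintype.card_bool, smul_eq_mul,
            mul_one]
          exact Nat.pow_le_pow_right (by norm_num) (le_max_left _ _)
  · -- each label is admitted by at most one overhang: swap the double count
    push Not at hbo
    have hswap : ∑ o : List.Vector Bool (overLen k pos t),
        (Finset.univ.filter fun b : BlockVar k pos t => Compat (List.ofFn b) o.1).card =
        ∑ b : BlockVar k pos t, (Finset.univ.filter
          fun o : List.Vector Bool (overLen k pos t) => Compat (List.ofFn b) o.1).card := by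
      simp_rw [Finset.card_filter]
      exact Finset.sum_comm
    rw [hswap]
    calc ∑ b : BlockVar k pos t, (Finset.univ.filter
          fun o : List.Vector Bool (overLen k pos t) => Compat (List.ofFn b) o.1).card
        ≤ ∑ _b : BlockVar k pos t, 1 := by
          refine Finset.sum_le_sum fun b _ => Finset.card_le_one.2 fun o ho o' ho' => ?_
          rw [Finset.mem_filter] at ho ho'
          have hlen : o.1.length ≤ (List.ofFn b).length := by
            rw [List.length_ofFn, o.2]; exact hbo.le
          have hlen' : o'.1.length ≤ (List.ofFn b).length := by
            rw [List.length_ofFn, o'.2]; exact hbo.le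
          have h1 := (compat_iff_prefix_of_le hlen).1 ho.2
          have h2 := (compat_iff_prefix_of_le hlen').1 ho'.2
          exact Subtype.ext (eq_of_prefix_of_prefix h1 h2 (by rw [o.2, o'.2]))
      _ ≤ _ := by
          rw [Finset.sum_const, Finset.card_univ, card_blockVar, smul_eq_mul, mul_one]
          exact Nat.pow_le_pow_right (by norm_num) (le_max_right _ _)

/-- In merge position with EQUAL streams the overhang is empty. [cite: LimayeSrinivasanTavenas2025, Lemma 22] -/
theorem overLen_eq_zero_of_le_of_le (t : Fin D) (h1 : streamLen k pos (pos t) t ≤ streamLen k pos (!pos t) t)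
    (h2 : streamLen k pos (!pos t) t ≤ streamLen k pos (pos t) t) : overLen k pos t = 0 := by
  rw [overLen_eq k pos (pos t) t]
  omega

/-- **Merge layers are sparse**: in merge position, layer `t` has at most
`2^{max(|w_{[t]}|, |w_t|)}` transitions (a push happens only onto an EMPTY overhang).
[cite: LimayeSrinivasanTavenas2025, Lemma 22] -/
theorem edges_wordStep_le_of_mergeAt (t : Fin D) (hm : streamLen k pos (pos t) t ≤ streamLen k pos (!pos t) t) :
    edges (St := fun t => List.Vector Bool (overLen k pos t)) (wordStep k pos) t ≤ 2 ^ max (overLen k pos t) (letterSize k pos t) := by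
  by_cases h2 : streamLen k pos (!pos t) t ≤ streamLen k pos (pos t) t
  · refine (edges_wordStep_le k pos t).trans ?_
    rw [overLen_eq_zero_of_le_of_le k pos t hm h2, pow_zero, one_mul, Nat.zero_max]
  · exact edges_wordStep_le_of_lt k pos t (by omega)

/-- **Overhang recursion in merge position**: `|w_{[t+1]}| = ||w_{[t]}| - |w_t||` (truncated
subtractions). [cite: LimayeSrinivasanTavenas2025, Lemma 22] -/
theorem overLen_succ_of_mergeAt (t : Fin D) (hm : streamLen k pos (pos t) t ≤ streamLen k pos (!pos t) t) :
    overLen k pos (t.val + 1) =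
      (overLen k pos t - letterSize k pos t) + (letterSize k pos t - overLen k pos t) := by
  by_cases h2 : streamLen k pos (!pos t) t ≤ streamLen k pos (pos t) t
  · rw [overLen_succ_of_le k pos t h2, overLen_eq_zero_of_le_of_le k pos t hm h2]
    omega
  · exact overLen_succ_of_lt k pos t (by omega)

/-- At the start both streams are empty. [cite: LimayeSrinivasanTavenas2025, Lemma 22] -/
theorem overLen_zero : overLen k pos 0 = 0 := by
  simp [overLen, streamLen]

end Queue

/-! ## §3 The potential argument: `Φ_t = 2 · 2^{|w_{[t]}|}` -/

/-- One step of the potential argument: transitions `2^{max(r,ℓ)}` plus the new potential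
`2·2^{|r-ℓ|}` are paid by the old potential `2·2^r` and `3·2^ℓ` (needs `ℓ ≥ 1`). [folklore] -/
theorem pow_max_add_le (r ℓ : ℕ) (hℓ : 1 ≤ ℓ) :
    2 ^ max r ℓ + 2 * 2 ^ ((r - ℓ) + (ℓ - r)) ≤ 2 * 2 ^ r + 3 * 2 ^ ℓ := by
  rcases le_total ℓ r with h | h
  · rw [max_eq_left h, Nat.sub_eq_zero_of_le h, add_zero]
    have h1 : 2 * 2 ^ (r - ℓ) ≤ 2 ^ r := by
      calc 2 * 2 ^ (r - ℓ) ≤ 2 * 2 ^ (r - 1) :=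
            Nat.mul_le_mul_left _ (Nat.pow_le_pow_right (by norm_num) (by omega))
        _ = 2 ^ (r - 1 + 1) := by rw [pow_succ']
        _ = 2 ^ r := by rw [Nat.sub_add_cancel (hℓ.trans h)]
    omega
  · rw [max_eq_right h, Nat.sub_eq_zero_of_le h, zero_add]
    have h1 : 2 ^ (ℓ - r) ≤ 2 ^ ℓ := Nat.pow_le_pow_right (by norm_num) (by omega)
    omega

/-- **The potential bound**: for `r₀ = 0`, `r_{t+1} = |r_t - ℓ_t|`, `ℓ_t ≥ 1`,
`∑_{t<n} 2^{max(r_t, ℓ_t)} + 2·2^{r_n} ≤ 2 + 3 ∑_{t<n} 2^{ℓ_t}`. [folklore] -/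
theorem sum_pow_max_add_le (r ℓ : ℕ → ℕ) (h0 : r 0 = 0) (n : ℕ)
    (hrec : ∀ t < n, r (t + 1) = (r t - ℓ t) + (ℓ t - r t)) (hℓ : ∀ t < n, 1 ≤ ℓ t) :
    ∑ t ∈ Finset.range n, 2 ^ max (r t) (ℓ t) + 2 * 2 ^ r n ≤
      2 + 3 * ∑ t ∈ Finset.range n, 2 ^ ℓ t := by
  induction n with
  | zero => simp [h0]
  | succ n ih =>
    have ih' := ih (fun t ht => hrec t (Nat.lt_succ_of_lt ht)) (fun t ht => hℓ t (Nat.lt_succ_of_lt ht))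
    have hstep := pow_max_add_le (r n) (ℓ n) (hℓ n (Nat.lt_succ_self n))
    rw [Finset.sum_range_succ, Finset.sum_range_succ, hrec n (Nat.lt_succ_self n), Nat.mul_add]
    omega

/-- Hence `∑_{t<n} 2^{max(r_t, ℓ_t)} ≤ 3 ∑_{t<n} 2^{ℓ_t}`. [folklore] -/
theorem sum_pow_max_le (r ℓ : ℕ → ℕ) (h0 : r 0 = 0) (n : ℕ)
    (hrec : ∀ t < n, r (t + 1) = (r t - ℓ t) + (ℓ t - r t)) (hℓ : ∀ t < n, 1 ≤ ℓ t) :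
    ∑ t ∈ Finset.range n, 2 ^ max (r t) (ℓ t) ≤ 3 * ∑ t ∈ Finset.range n, 2 ^ ℓ t := by
  have h := sum_pow_max_add_le r ℓ h0 n hrec hℓ
  have h1 : 1 ≤ 2 ^ r n := Nat.one_le_two_pow
  omega

/-! ## §4 Words in merge order have linear complexity -/

section Merge

variable {D : ℕ} (k : ℕ) (pos : Fin D → Bool) (K : Type*) [CommSemiring K]

/-- `P_w` is the accepted-word polynomial of the queue automaton (tree `accepts_wordStep_iff`).
[cite: LimayeSrinivasanTavenas2025, Lemma 22] -/
theorem wordPoly_eq_acceptedPoly :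
    wordPoly k pos K = ∑ w : (t : Fin D) → BlockVar k pos t,
      if LayeredAutomaton.Accepts (St := fun t => List.Vector Bool (overLen k pos t))
          (wordStart k pos) (wordStep k pos) w then ∏ t : Fin D, X ⟨t, w t⟩ else 0 := by
  unfold wordPoly
  refine Finset.sum_congr rfl fun w _ => if_congr (accepts_wordStep_iff k pos w).symm rfl rfl

/-- **Words in merge order are cheap**: if EVERY block is appended to the shorter-or-equal
stream and all letters are `≥ 1`, then `L(P_w) ≤ 6 · ∑_t 2^{|w_t|} = 6 · #variables`
(sparse-automaton engine `complexity_acceptedPoly_le` + `edges_wordStep_le_of_mergeAt` + the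
potential bound `sum_pow_max_le`). [cite: LimayeSrinivasanTavenas2025, Lemma 22] -/
theorem complexity_wordPoly_le_of_merge (hm : ∀ t : Fin D, streamLen k pos (pos t) t ≤ streamLen k pos (!pos t) t)
    (hℓ : ∀ t : Fin D, 1 ≤ letterSize k pos t) :
    complexity (wordPoly k pos K) ≤ 6 * ∑ t : Fin D, 2 ^ letterSize k pos t := by
  classical
  rw [wordPoly_eq_acceptedPoly]
  refine (complexity_acceptedPoly_le (K := K) (St := fun t => List.Vector Bool (overLen k pos t)) (wordStart k pos)
    (wordStep k pos)).trans ?_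
  -- the letter sequence as a function on `ℕ`
  set ℓ : ℕ → ℕ := fun t => if h : t < D then letterSize k pos ⟨t, h⟩ else 1 with hℓdef
  have hℓ' : ∀ t : Fin D, ℓ t = letterSize k pos t := fun t => by
    simp only [hℓdef, dif_pos t.2]
  have hedges : ∑ t : Fin D, edges (St := fun t => List.Vector Bool (overLen k pos t)) (wordStep k pos) t ≤
      ∑ t ∈ Finset.range D, 2 ^ max (overLen k pos t) (ℓ t) := by
    rw [← Fin.sum_univ_eq_sum_range (fun t => 2 ^ max (overLen k pos t) (ℓ t))]
    exact Finset.sum_le_sum fun t _ => (edges_wordStep_le_of_mergeAt k pos t (hm t)).trans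
      (by rw [hℓ'])
  have hpot := sum_pow_max_le (overLen k pos) ℓ (overLen_zero k pos) D
    (fun t ht => by rw [hℓ' ⟨t, ht⟩]; exact overLen_succ_of_mergeAt k pos ⟨t, ht⟩ (hm _))
    (fun t ht => by rw [hℓ' ⟨t, ht⟩]; exact hℓ _)
  have hsum : ∑ t ∈ Finset.range D, 2 ^ ℓ t = ∑ t : Fin D, 2 ^ letterSize k pos t := by
    rw [← Fin.sum_univ_eq_sum_range (fun t => 2 ^ ℓ t)]
    exact Finset.sum_congr rfl fun t _ => by rw [hℓ']
  rw [hsum] at hpot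
  omega

end Merge

end ProductDepthWallTwo

end Summit.ValiantsHypothesis.ValiantsHypothesis.Theorems.BarrierLeverDefinableEquations
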